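import Literature.Barriers.CriticalPhenomena.KozmaNachmiasLemma23B3
import HarnessLib

/-!
# Barrier audit of `LaceExpansionHighDimension` (Cor. 11.7): the one-arm upper bound ALONE forces
# `d ≥ 6` — the hypothesis "`η = 0` in `x`-space" is superfluous

Barrier catalogue `Literature/Barriers/CriticalPhenomena/` (D-0021), companion of
`LaceExpansionHighDimension.lean` / `LaceExpansionHighDimensionProofs.lean` (conjunct
`PercolationContinuityZ3`). The catalogued barrier `LaceExpansionHighDimension` is Cor. 11.7 of
Heydenreich–van der Hofstad 2017 as printed: "`ρ_ex = 1/2` and `η = 0` in `x`-space imply `d ≥ 6`",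
and its `scope_caveats:` line records that "Cor. 11.7 needs BOTH inputs … and refutes only their
conjunction in `d ≤ 5`". The audit (2026-08) found that the printed corollary UNDERSTATES the
obstruction: by the hyperscaling inequality `η₁ ≤ d/(1+δ)` of Borgs–Chayes–Kesten–Spencer 1999
together with the mean-field bound `δ ≥ 2` of Aizenman–Barsky 1987, the one-arm exponent obeys
`η₁ ≤ d/3` in every dimension, so "`η₁ = 2` cannot occur for `d ≤ 5`" (Dewan–Muirhead 2022, §1.1,
p. 4 of arXiv:2102.12123: "it implies `d_c ≥ 6` since it shows that `η₁ = 2` cannot occur for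
`d ≤ 5`"). In the catalogue's terms: the upper half `P_{p_c}(0 ↔ ∂Λ_n) ≤ C/n²` of `RhoExHalf d`
is by itself impossible for `d ≤ 5` — no two-point (`η = 0`) input is needed, only the
unconditional magnetization bound of Aizenman–Barsky.

## What is PROVED here (sorry-free)

A direct quantitative version of that mechanism, for bond percolation on `ℤ^d` at an arbitrary
parameter `p`:

* `tau_le_oneArmProb_sq_of_coord` — the two-disjoint-boxes bound (11.4.1)–(11.4.2) for a general
  far point: `|v_i| ≥ 2n+1` for some coordinate `i` implies `τ_p(0,v) ≤ P_p(0 ↔ ∂Λ_n)²`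
  (generalising `tau_farPoint_le_oneArmProb_sq`, which treats `v = 3n e₁`);
* `real_clusterSizeGe_le_oneArmProb_add` — the squeeze
  `P_p(|C(0)| ≥ s) ≤ P_p(0 ↔ ∂Λ_n) + (1/s) Σ_{x ∈ Λ_n} τ_p(0,x)` (if `0 ↮ ∂Λ_n` then `C(0) ⊆ Λ_n`,
  and Markov for `|{x ∈ Λ_n : 0 ↔ x}|`);
* `sum_tau_box_le_of_oneArm_upper` — for `1 ≤ d ≤ 5`, an upper bound `P_p(0 ↔ ∂Λ_m) ≤ C/m²`
  (`m ≥ 1`) gives `Σ_{x ∈ Λ_n} τ_p(0,x) ≤ (5^d + 512 d 3^{d-1} C²) n` (`τ(0,x) ≤ 256 C²/‖x‖_∞⁴` on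
  `Λ_n ∖ Λ_2` by the two-boxes bound with `m = ⌊(‖x‖_∞ - 1)/2⌋`, and the shell sums of
  `LaceExpansionHighDimensionProofs.lean`);
* `magnetization_le_oneArmProb_add` — Abel summation of the squeeze into the magnetization
  `M(p,γ) = E_p[1 - (1-γ)^{|C(0)|}] = γ Σ_{s ≥ 0} (1-γ)^s P_p(|C(0)| ≥ s+1)`
  (Heydenreich–van der Hofstad 2017, (3.4.1)):
  `M(p,γ) ≤ P_p(0 ↔ ∂Λ_n) + (Σ_{x∈Λ_n} τ_p(0,x)) · γ log(1/γ)/(1-γ)`;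
* `six_le_of_oneArm_upper_of_magnetization` — **the sharpened barrier**: on `ℤ^d`, `d ≥ 1`, at any
  `p`, the magnetization lower bound `M(p,γ) ≥ c √γ` (`0 < γ < 1`) together with the one-arm upper
  bound `P_p(0 ↔ ∂Λ_n) ≤ C/n²` (`n ≥ 1`) forces `d ≥ 6` (take `γ = 1/(λ n⁴)`: the two displays give
  `c/√λ ≤ C + 2K log(λ n⁴)/(λ n)` for all large `n`, and the right side tends to `C`);
* the catalogue forms `RhoExHalf.six_le_of_magnetization`,
  `not_rhoExHalf_of_le_five_of_magnetization`, and the named, PROVED statement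
  `MeanFieldOneArmHighDimension` / `MeanFieldOneArmHighDimension_holds` (Cor. 11.7 with the
  hypothesis `EtaZeroXSpace d` replaced by the magnetization bound at `p_c`).

Relation to the concurrent audit of `LaceExpansionHighDimension.lean` (appended there as
`LaceExpansionHighDimensionNarrow`, 2026-08-15): that statement is the two-point / triangle side —
a lower bound `τ_{p_c}(0,x) ≥ c‖x‖^{-a}` with `3a ≤ 2d` is incompatible with `T(p_c) < ∞`, no
one-arm input — and its `evasions_known` line records that "`d_c ≥ 6` is otherwise known only
conditionally on the existence of exponents (Tasaki; Chayes–Chayes)". The present file is the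
complementary one-arm side and removes that proviso for the arm exponent: no existence-of-exponents
assumption and no two-point input enter, only the (unconditional) magnetization bound.

At `p = p_c` the magnetization hypothesis is Aizenman–Barsky 1987, Thm. 1.2 ((1.10):
"`M(β_T, h) ≥ const h^{1/2}`", with `β_T = β_H`, ibid. Thm. 1.1), i.e. the mean-field bound `δ ≥ 2`
in its printed (generating-function) form (Heydenreich–van der Hofstad 2017, Prop. 3.6 and
Cor. 4.5; Grimmett 1999, Prop. (5.49) and (10.29)); it holds in EVERY dimension `d ≥ 2`, and is
trivial if `θ(p_c) > 0` (then `M(p_c,γ) ≥ θ(p_c)`). It is kept as an explicit hypothesis (no new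
named fact, D-0026); the pointwise tail form `P_{p_c}(|C| ≥ n) ≥ c/√n` is NOT assumed, since only
the generating-function form is printed unconditionally.

## Consequences for the catalogue (audit outcome)

* `LaceExpansionHighDimension` (Cor. 11.7) is CONFIRMED and STRENGTHENED: its `technique_class`
  should read "any argument whose output on `ℤ^d`, `d ≤ 5`, includes the one-arm upper bound
  `P_{p_c}(0 ↔ ∂Λ_n) ≤ C n^{-2}` (mean-field `ρ_ex`)", with no `η = 0` clause; its `scope_caveats`
  line "refutes only their conjunction in `d ≤ 5`" is superseded by
  `not_rhoExHalf_of_le_five_of_magnetization`. What remains NOT excluded is unchanged: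
  `TriangleCondition 3`, an infrared bound in `d = 3`, or any verification of `θ(p_c) = 0` in
  `d = 3` that does not output mean-field arm decay.
* `LaceExpansionHighDimensionProofs.lean`: its named fact `KozmaNachmias2011_oneArmUpper` is the
  conditional Thm. 1 of Kozma–Nachmias 2011 (§1.1: `d > 6`, `τ_{p_c}(0,x) ≈ |x|^{2-d}`, symmetry of
  the edge set) specialised to the nearest-neighbour lattice — faithful (audit: arXiv:0911.0871,
  §1.1 and §1.6 for `∂Q_r` = inner vertex boundary; `oneArmProb` is that event). New literature on
  its discharge: van Engelenburg–Garban–Panis–Severo 2025 (arXiv:2510.21595, Thm. 1.1) re-prove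
  `P_{p_c}(0 ↔ Λ_n^c) ≍ n^{-2}` for spread-out percolation, `d > 6`, in a few pages from the
  near-critical inputs of Duminil-Copin–Panis 2024 (`χ(p) ≍ (p_c-p)^{-1}`, sharp length
  `L(p) ≍ (p_c-p)^{-1/2}`, half-space decay of `φ_p`) via the Dewan–Muirhead entropic bound, without
  the lace expansion and without the Kozma–Nachmias regularity theory ("the restriction to
  spread-out percolation is somewhat artificial", ibid. §1.1).

## References

* M. Aizenman, D. J. Barsky, *Sharpness of the phase transition in percolation models*, Comm.
  Math. Phys. 108 (1987) 489–526: Thm. 1.1 (`β_T = β_H`), Thm. 1.2 and (1.10)–(1.13) (p. 493),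
  Thm. 4.2.
* C. Borgs, J. T. Chayes, H. Kesten, J. Spencer, *Uniform boundedness of critical crossing
  probabilities implies hyperscaling*, Random Structures Algorithms 15 (1999) 368–413.
* V. Dewan, S. Muirhead, *Upper bounds on the one-arm exponent for dependent percolation models*,
  Probab. Theory Related Fields 185 (2022) 41–88 (arXiv:2102.12123): Thm. 1.1 (`η₁ ≤ d/3`, `d ≥ 3`),
  §1.1 (the sentence "it implies `d_c ≥ 6` …"), Thm. 1.10 and Remark 1.13, §2 (proof of Thm. 1.1:
  `{0 ↔ v} ⊆ {0 ↔ Λ_{⌊|v|/2⌋}} ∘ {v ↔ v + Λ_{⌊|v|/2⌋}}`).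
* M. Heydenreich, R. van der Hofstad, *Progress in High-Dimensional Percolation and Random Graphs*,
  Springer 2017: (3.4.1) (magnetization), Prop. 3.6, Cor. 4.5, Thm. 11.5, Cor. 11.7 (pp. 144–145).
* G. Grimmett, *Percolation*, 2nd ed., Springer 1999: Prop. (5.49), Prop. (10.29) and its proof.
* G. Kozma, A. Nachmias, J. Amer. Math. Soc. 24 (2011) 375–409 (arXiv:0911.0871): Thm. 1
  (conditional version, §1.1), §1.6.
* D. van Engelenburg, C. Garban, R. Panis, F. Severo, arXiv:2510.21595 (2025): Thm. 1.1, §1.1–1.2.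
* H. Duminil-Copin, R. Panis, arXiv:2410.03647 (2024).
-/

noncomputable section

namespace Literature.Barriers.CriticalPhenomena

open _root_.MeasureTheory _root_.Filter _root_.Topology Finset Literature.Probability.LatticeModels
  Literature.Probability.Percolation Literature.Probability.Percolation.PlanarDuality
  Literature.Probability.Percolation.DCT16
open scoped Literature.Probability.LatticeModels Literature.Probability.Percolation

variable {d : ℕ}

/-! ### (11.4.2) for a general far point: two disjoint boxes -/

section TwoBoxes

/-- **Two disjoint boxes** (the mechanism (11.4.1)–(11.4.2) of Heydenreich–van der Hofstad 2017,
Cor. 11.7, for a general far point; Dewan–Muirhead 2022, proof of Thm. 1.1: "`{0 ↔ v}` implies the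
occurrence of `{0 ↔ Λ_{⌊|v|_∞/2⌋}}` and `{v ↔ v + Λ_{⌊|v|_∞/2⌋}}`, which depend on disjoint subsets
of edges"): if `|v_i| ≥ 2n + 1` for some coordinate `i`, then for every `p`,
`τ_p(0, v) ≤ P_p(0 ↔ ∂Λ_n)²` — if `0 ↔ v` then `0 ↔ ∂Λ_n` inside `Λ_n` and `v ↔ v + ∂Λ_n` inside
`v + Λ_n`, two events determined by the edge sets of the vertex-disjoint boxes `Λ_n`, `v + Λ_n`,
hence independent, and of equal probability by translation invariance.
[cite: HeydenreichVanDerHofstad2017, proof of Cor. 11.7, (11.4.1)–(11.4.2) (p. 145)]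
[cite: DewanMuirhead2022, §2, proof of Thm. 1.1] -/
theorem tau_le_oneArmProb_sq_of_coord (n : ℕ) (p : unitInterval) {v : Site d} (i : Fin d)
    (hvi : 2 * (n : ℤ) + 1 ≤ |v i|) : tau d p 0 v ≤ oneArmProb d p n ^ 2 := by
  classical
  set S : Set (BondConfig (Site d)) := siteToBoundary d n with hS
  set e2 : Sym2 (Site d) ≃ Sym2 (Site d) := sym2Equiv (Site.shift (-v)) with he2
  set T : Set (BondConfig (Site d)) := BondConfig.relabel e2 ⁻¹' S with hT
  have h0box : (0 : Site d) ∈ box d n := by simp [mem_box]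
  have hvi' : v i ≤ -(2 * (n : ℤ) + 1) ∨ 2 * (n : ℤ) + 1 ≤ v i := le_abs'.1 hvi
  have hvbox : v ∉ box d n := by
    intro h; have h1 := (mem_box.1 h) i; omega
  have hnegvbox : -v ∉ box d n := by
    intro h; have h1 := (mem_box.1 h) i; simp only [Pi.neg_apply] at h1; omega
  -- (11.4.1): almost surely `{0 ↔ v} ⊆ S ∩ T`
  have hae : ∀ᵐ ω ∂(bondPercolation (zdGraph d) p),
      ω ∈ (openConn 0 v : Set (BondConfig (Site d))) → ω ∈ S ∩ T := by
    have hsub : ∀ᵐ ω ∂(bondPercolation (zdGraph d) p), ω ⊆ (zdGraph d).edgeSet :=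
      ProbabilityTheory.setBernoulli_ae_subset
    filter_upwards [hsub] with ω hω hconn
    have hle : openGraph ω ≤ zdGraph d := openGraph_le_of_subset hω
    have hconn' : (openGraph ω).Reachable 0 v := hconn
    obtain ⟨w⟩ := hconn'
    constructor
    · obtain ⟨b, hb, hu, hb', hreach⟩ :=
        exists_innerBoundary_reachable_of_walk hle (box d n) w h0box hvbox
      exact ⟨b, hb, hu, hb', hreach⟩
    · set ω' : BondConfig (Site d) := BondConfig.relabel e2 ω with hω'
      change ω' ∈ S
      let φ : openGraph ω ≃g openGraph ω' :=
        { toEquiv := Site.shift (-v)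
          map_rel_iff' := fun {a b} => openGraph_relabel_adj_iff (Site.shift (-v)) ω a b }
      have hreach' : (openGraph ω').Reachable 0 (-v) := by
        have h1 : (openGraph ω').Reachable (φ 0) (φ v) :=
          SimpleGraph.Reachable.map φ.toHom ⟨w⟩
        have e0 : φ v = 0 := by show v + -v = 0; simp
        have e1 : φ 0 = -v := by show (0 : Site d) + -v = -v; simp
        rw [e0, e1] at h1
        exact h1.symm
      have hω'sub : ω' ⊆ (zdGraph d).edgeSet := by
        intro z hz
        rw [hω', BondConfig.mem_relabel_iff] at hz
        have hzE : e2.symm z ∈ (zdGraph d).edgeSet := hω hz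
        let ψ : zdGraph d ≃g zdGraph d :=
          { toEquiv := Site.shift (-v)
            map_rel_iff' := fun {a b} => zdGraph_adj_shift_iff (-v) a b }
        have key := sym2Equiv_mem_edgeSet_iff ψ (e2.symm z)
        have hz' : sym2Equiv ψ.toEquiv (e2.symm z) = z := e2.apply_symm_apply z
        rw [hz'] at key
        exact key.2 hzE
      have hle' : openGraph ω' ≤ zdGraph d := openGraph_le_of_subset hω'sub
      obtain ⟨w'⟩ := hreach'
      obtain ⟨b, hb, hu, hb', hreach⟩ :=
        exists_innerBoundary_reachable_of_walk hle' (box d n) w' h0box hnegvbox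
      exact ⟨b, hb, hu, hb', hreach⟩
  have hmono : (bondPercolation (zdGraph d) p).real (openConn 0 v) ≤
      (bondPercolation (zdGraph d) p).real (S ∩ T) :=
    ENNReal.toReal_mono (measure_ne_top _ _) (measure_mono_ae hae)
  -- independence of `S` and `T` (disjoint edge sets)
  have hSdet : DeterminedBy S (↑((box d n).sym2) : Set (Sym2 (Site d))) :=
    determinedBy_siteToBoundary d n
  have hTdet : DeterminedBy T (e2 ⁻¹' ↑((box d n).sym2)) := determinedBy_preimage_relabel e2 hSdet
  have hSm : MeasurableSet S := hSdet.measurableSet_of_finset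
  have hTm : MeasurableSet T := (BondConfig.relabel e2).measurable hSm
  have hdisj : Disjoint (↑((box d n).sym2) : Set (Sym2 (Site d))) (e2 ⁻¹' ↑((box d n).sym2)) := by
    rw [Set.disjoint_left]
    intro z hz1 hz2
    simp only [Set.mem_preimage, Finset.mem_coe, Finset.mem_sym2_iff] at hz1 hz2
    obtain ⟨a, ha⟩ : ∃ a, a ∈ z := ⟨z.out.1, Sym2.out_fst_mem z⟩
    have ha1 := hz1 a ha
    have ha2 : a + -v ∈ box d n := by
      apply hz2
      rw [he2, sym2Equiv_apply]
      exact Sym2.mem_map.2 ⟨a, ha, rfl⟩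
    have h1 := (mem_box.1 ha1) i
    have h2 := (mem_box.1 ha2) i
    simp only [Pi.add_apply, Pi.neg_apply] at h2
    omega
  have hprod : (bondPercolation (zdGraph d) p).real (S ∩ T) =
      (bondPercolation (zdGraph d) p).real S * (bondPercolation (zdGraph d) p).real T :=
    bondPercolation_real_inter_of_disjoint (zdGraph d) p hdisj hSdet hTdet hSm hTm
  -- translation invariance
  have hT_eq : (bondPercolation (zdGraph d) p).real T = (bondPercolation (zdGraph d) p).real S :=
    bondPercolation_real_preimage_shift (-v) p S
  calc tau d p 0 v = (bondPercolation (zdGraph d) p).real (openConn 0 v) := rfl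
    _ ≤ (bondPercolation (zdGraph d) p).real (S ∩ T) := hmono
    _ = oneArmProb d p n ^ 2 := by rw [hprod, hT_eq, sq]; rfl

end TwoBoxes

/-! ### The squeeze `P(|C(0)| ≥ s) ≤ P(0 ↔ ∂Λ_n) + E|C(0) ∩ Λ_n|/s` -/

section Squeeze

open scoped Classical in
/-- **Squeeze**: for every `p`, `n` and `s ≥ 1`,
`P_p(|C(0)| ≥ s) ≤ P_p(0 ↔ ∂Λ_n) + (1/s) Σ_{x ∈ Λ_n} τ_p(0, x)` — on `{0 ↮ ∂Λ_n}` the cluster of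
the origin lies inside `Λ_n` (an open path leaving `Λ_n` passes through `∂Λ_n`), so
`|C(0)| = |{x ∈ Λ_n : 0 ↔ x}|`, whose tail is bounded by Markov's inequality
(`mul_real_card_filter_ge_le_sum`). (The standard first step of the hyperscaling bound
`η₁ ≤ d/(1+δ)`.) [cite: BorgsChayesKestenSpencer1999, §1 (hyperscaling for the one-arm exponent)]
[cite: DewanMuirhead2022, §1.1 and §2 (proof of Thm. 1.1)] -/
theorem real_clusterSizeGe_le_oneArmProb_add (p : unitInterval) (n : ℕ) {s : ℕ} (hs : 1 ≤ s) :
    (bondPercolation (zdGraph d) p).real (clusterSizeGe (0 : Site d) s) ≤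
      oneArmProb d p n + (∑ x ∈ box d n, tau d p 0 x) / s := by
  classical
  set μ := bondPercolation (zdGraph d) p with hμ
  set E : Site d → Set (BondConfig (Site d)) := fun x => openConn (0 : Site d) x with hE
  set B : Set (BondConfig (Site d)) :=
    {ω | (s : ℝ) ≤ (((box d n).filter fun x => ω ∈ E x).card : ℝ)} with hB
  have hstep1 : μ.real (clusterSizeGe (0 : Site d) s) ≤ μ.real (oneArm d n ∪ B) := by
    refine real_mono_of_forall_subset_edgeSet (zdGraph d) p fun ω hω hmem => ?_
    by_cases harm : ω ∈ oneArm d n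
    · exact Or.inl harm
    · refine Or.inr ?_
      -- every vertex of `C(0)` lies in `Λ_n`
      have hsubset : openCluster ω (0 : Site d) ⊆ ↑((box d n).filter fun x => ω ∈ E x) := by
        intro y hy
        have hy' : (openGraph ω).Reachable 0 y := hy
        rw [Finset.coe_filter]
        refine ⟨?_, hy'⟩
        by_contra hyb
        obtain ⟨w⟩ := hy'
        obtain ⟨b, hb, hu, hb', hr⟩ := exists_innerBoundary_reachable_of_walk
          (openGraph_le_of_subset hω) (box d n) w (zero_mem_box d n) hyb
        exact harm ⟨b, hb, hu, hb', hr⟩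
      have hcard : (openCluster ω (0 : Site d)).encard ≤
          (((box d n).filter fun x => ω ∈ E x).card : ℕ∞) := by
        rw [← Set.encard_coe_eq_coe_finsetCard]
        exact Set.encard_le_encard hsubset
      have hmem' : (s : ℕ∞) ≤ (openCluster ω (0 : Site d)).encard := hmem
      have hle : s ≤ ((box d n).filter fun x => ω ∈ E x).card := by
        exact_mod_cast hmem'.trans hcard
      show (s : ℝ) ≤ (((box d n).filter fun x => ω ∈ E x).card : ℝ)
      exact_mod_cast hle
  have hstep2 : μ.real (oneArm d n ∪ B) ≤ μ.real (oneArm d n) + μ.real B :=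
    measureReal_union_le _ _
  have hstep3 : (s : ℝ) * μ.real B ≤ ∑ x ∈ box d n, tau d p 0 x := by
    have h := mul_real_card_filter_ge_le_sum μ (box d n) (E := E)
      (fun x _ => measurableSet_openConn_holds (0 : Site d) x) (s : ℝ)
    exact h
  have hs0 : (0 : ℝ) < s := by exact_mod_cast hs
  have hB' : μ.real B ≤ (∑ x ∈ box d n, tau d p 0 x) / s := by
    rw [le_div_iff₀ hs0, mul_comm]; exact hstep3
  calc μ.real (clusterSizeGe 0 s) ≤ μ.real (oneArm d n ∪ B) := hstep1
    _ ≤ μ.real (oneArm d n) + μ.real B := hstep2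
    _ ≤ oneArmProb d p n + (∑ x ∈ box d n, tau d p 0 x) / s := add_le_add le_rfl hB'

end Squeeze

/-! ### `Σ_{x ∈ Λ_n} τ(0,x) ≤ K n` in `d ≤ 5` under the one-arm upper bound -/

section LatticeSum

/-- **The expected cluster size in a box under the one-arm upper bound**: on `ℤ^d` with
`1 ≤ d ≤ 5`, if `P_p(0 ↔ ∂Λ_m) ≤ C/m²` for all `m ≥ 1`, then
`Σ_{x ∈ Λ_n} τ_p(0,x) ≤ (5^d + 512 d 3^{d-1} C²) n` for all `n ≥ 1`: on `Λ_2`, `τ ≤ 1` and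
`|Λ_2| = 5^d`; for `‖x‖_∞ = k ≥ 3` the two-boxes bound with `m = ⌊(k-1)/2⌋` (`2m+1 ≤ k ≤ 4m`) gives
`τ(0,x) ≤ (C/m²)² ≤ 256 C²/k⁴`, and `Σ_{3 ≤ k ≤ n} |∂Λ_k| k^{-4} ≤ 2d 3^{d-1} Σ_k k^{d-5} ≤ 2d 3^{d-1} n`
(Dewan–Muirhead 2022, proof of Thm. 1.1: "via an integral comparison,
`Σ_{v ∈ Λ_R} P[A_1(⌊|v|/2⌋)]² ≤ max{R^{d-2η*}, 1} log R`", here with `η* = 2`).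
[cite: DewanMuirhead2022, §2, proof of Thm. 1.1 ((2.?) integral comparison)] -/
theorem sum_tau_box_le_of_oneArm_upper (hd1 : 1 ≤ d) (hd5 : d ≤ 5) (p : unitInterval) {C : ℝ}
    (hρ : ∀ m : ℕ, 1 ≤ m → oneArmProb d p m ≤ C / (m : ℝ) ^ 2) {n : ℕ} (hn : 1 ≤ n) :
    ∑ x ∈ box d n, tau d p 0 x ≤ (5 ^ d + 512 * d * 3 ^ (d - 1) * C ^ 2) * n := by
  classical
  have hn1 : (1 : ℝ) ≤ n := by exact_mod_cast hn
  -- the small box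
  have hsmall : ∀ m : ℕ, m ≤ 2 → ∑ x ∈ box d m, tau d p 0 x ≤ 5 ^ d := by
    intro m hm
    calc ∑ x ∈ box d m, tau d p 0 x ≤ ∑ x ∈ box d 2, tau d p 0 x :=
          Finset.sum_le_sum_of_subset_of_nonneg (box_mono d hm) fun x _ _ => tau_nonneg p 0 x
      _ ≤ ∑ _x ∈ box d 2, (1 : ℝ) := Finset.sum_le_sum fun x _ => tau_le_one p 0 x
      _ = 5 ^ d := by
          rw [Finset.sum_const, card_box, nsmul_eq_mul, mul_one]
          norm_num
  have h5 : (5 : ℝ) ^ d ≤ 5 ^ d * n := le_mul_of_one_le_right (by positivity) hn1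
  have hK0 : (0 : ℝ) ≤ 512 * d * 3 ^ (d - 1) * C ^ 2 * n := by positivity
  rcases le_or_gt n 2 with hn2 | hn2
  · calc ∑ x ∈ box d n, tau d p 0 x ≤ 5 ^ d := hsmall n hn2
      _ ≤ 5 ^ d * n + 512 * d * 3 ^ (d - 1) * C ^ 2 * n := by linarith
      _ = (5 ^ d + 512 * d * 3 ^ (d - 1) * C ^ 2) * n := by ring
  · have h2n : 2 ≤ n := by omega
    -- pointwise bound on the annulus `Λ_n ∖ Λ_2`
    have hpt : ∀ x ∈ box d n \ box d 2,
        tau d p 0 x ≤ 256 * C ^ 2 * (((Site.supNorm x : ℕ) : ℝ) ^ 4)⁻¹ := by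
      intro x hx
      obtain ⟨-, hx2⟩ := Finset.mem_sdiff.1 hx
      rw [mem_box_iff_supNorm_le, not_le] at hx2
      have hne : (Finset.univ : Finset (Fin d)).Nonempty :=
        Finset.univ_nonempty_iff.2 ⟨⟨0, by omega⟩⟩
      obtain ⟨i, hi⟩ := Site.exists_natAbs_eq_supNorm hne x
      set k := Site.supNorm x with hk
      set m : ℕ := (k - 1) / 2 with hm
      have hm1 : 1 ≤ m := by omega
      have h2m : 2 * m + 1 ≤ k := by omega
      have hk4m : k ≤ 4 * m := by omega
      have hvi : 2 * (m : ℤ) + 1 ≤ |x i| := by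
        rw [← Int.natCast_natAbs, hi]
        exact_mod_cast h2m
      have h1 := tau_le_oneArmProb_sq_of_coord m p i hvi
      have hπ := hρ m hm1
      have hπ0 : 0 ≤ oneArmProb d p m := measureReal_nonneg
      have hm0 : (0 : ℝ) < m := by exact_mod_cast hm1
      have hk0 : (0 : ℝ) < k := by exact_mod_cast (show 0 < k by omega)
      have hkm : (k : ℝ) ^ 4 / 256 ≤ (m : ℝ) ^ 4 := by
        have : (k : ℝ) ≤ 4 * m := by exact_mod_cast hk4m
        have h' : (k : ℝ) ^ 4 ≤ (4 * m) ^ 4 := pow_le_pow_left₀ hk0.le this 4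
        rw [div_le_iff₀ (by norm_num : (0 : ℝ) < 256)]
        calc (k : ℝ) ^ 4 ≤ (4 * m) ^ 4 := h'
          _ = (m : ℝ) ^ 4 * 256 := by ring
      have hinv : ((m : ℝ) ^ 4)⁻¹ ≤ 256 * ((k : ℝ) ^ 4)⁻¹ := by
        rw [show (256 : ℝ) * ((k : ℝ) ^ 4)⁻¹ = ((k : ℝ) ^ 4 / 256)⁻¹ by rw [inv_div]; ring]
        exact inv_anti₀ (by positivity) hkm
      calc tau d p 0 x ≤ oneArmProb d p m ^ 2 := h1
        _ ≤ (C / (m : ℝ) ^ 2) ^ 2 := pow_le_pow_left₀ hπ0 hπ 2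
        _ = C ^ 2 * ((m : ℝ) ^ 4)⁻¹ := by rw [div_pow, ← pow_mul]; ring
        _ ≤ C ^ 2 * (256 * ((k : ℝ) ^ 4)⁻¹) := mul_le_mul_of_nonneg_left hinv (sq_nonneg C)
        _ = 256 * C ^ 2 * ((k : ℝ) ^ 4)⁻¹ := by ring
    have hsplit : ∑ x ∈ box d n, tau d p 0 x =
        ∑ x ∈ box d n \ box d 2, tau d p 0 x + ∑ x ∈ box d 2, tau d p 0 x :=
      (Finset.sum_sdiff (box_mono d h2n)).symm
    -- one shell: `|∂Λ_{k+1}| (k+1)^{-4} ≤ 2d 3^{d-1}` as `d - 1 ≤ 4`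
    have hshell : ∀ k : ℕ, (#(sphere d (k + 1)) : ℝ) * ((((k + 1 : ℕ) : ℝ)) ^ 4)⁻¹ ≤
        2 * d * 3 ^ (d - 1) := by
      intro k
      have hcard := card_sphere_succ_le' (d := d) hd1 k
      have hk1 : (1 : ℝ) ≤ (k : ℝ) + 1 := by
        have : (0 : ℝ) ≤ k := Nat.cast_nonneg k
        linarith
      have hpos : (0 : ℝ) < ((k : ℝ) + 1) ^ 4 := by positivity
      have hpow : ((k : ℝ) + 1) ^ (d - 1) ≤ ((k : ℝ) + 1) ^ 4 :=
        pow_le_pow_right₀ hk1 (by omega)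
      push_cast
      calc (#(sphere d (k + 1)) : ℝ) * (((k : ℝ) + 1) ^ 4)⁻¹
          ≤ 2 * d * 3 ^ (d - 1) * ((k : ℝ) + 1) ^ (d - 1) * (((k : ℝ) + 1) ^ 4)⁻¹ :=
            mul_le_mul_of_nonneg_right hcard (by positivity)
        _ ≤ 2 * d * 3 ^ (d - 1) * ((k : ℝ) + 1) ^ 4 * (((k : ℝ) + 1) ^ 4)⁻¹ := by
            gcongr
        _ = 2 * d * 3 ^ (d - 1) := by
            rw [mul_assoc, mul_inv_cancel₀ hpos.ne', mul_one]
    have hann : ∑ x ∈ box d n \ box d 2, tau d p 0 x ≤ 256 * C ^ 2 * (2 * d * 3 ^ (d - 1) * n) := by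
      calc ∑ x ∈ box d n \ box d 2, tau d p 0 x
          ≤ ∑ x ∈ box d n \ box d 2, 256 * C ^ 2 * (((Site.supNorm x : ℕ) : ℝ) ^ 4)⁻¹ :=
            Finset.sum_le_sum hpt
        _ = 256 * C ^ 2 *
              ∑ x ∈ box d n \ box d 2, (fun k : ℕ => ((k : ℝ) ^ 4)⁻¹) (Site.supNorm x) := by
            rw [Finset.mul_sum]
        _ = 256 * C ^ 2 *
              ∑ k ∈ Finset.Ico 2 n, (#(sphere d (k + 1)) : ℝ) * ((((k + 1 : ℕ) : ℝ)) ^ 4)⁻¹ := by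
            rw [sum_box_sdiff_box_eq_sum_Ico (fun k : ℕ => ((k : ℝ) ^ 4)⁻¹) h2n]
        _ ≤ 256 * C ^ 2 * ∑ _k ∈ Finset.Ico 2 n, (2 * d * 3 ^ (d - 1) : ℝ) :=
            mul_le_mul_of_nonneg_left (Finset.sum_le_sum fun k _ => hshell k) (by positivity)
        _ = 256 * C ^ 2 * (2 * d * 3 ^ (d - 1) * ((n - 2 : ℕ) : ℝ)) := by
            rw [Finset.sum_const, Nat.card_Ico, nsmul_eq_mul]; ring
        _ ≤ 256 * C ^ 2 * (2 * d * 3 ^ (d - 1) * n) := by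
            gcongr
            exact_mod_cast Nat.sub_le n 2
    calc ∑ x ∈ box d n, tau d p 0 x
        = ∑ x ∈ box d n \ box d 2, tau d p 0 x + ∑ x ∈ box d 2, tau d p 0 x := hsplit
      _ ≤ 256 * C ^ 2 * (2 * d * 3 ^ (d - 1) * n) + 5 ^ d := add_le_add hann (hsmall 2 le_rfl)
      _ = 512 * d * 3 ^ (d - 1) * C ^ 2 * n + 5 ^ d := by ring
      _ ≤ 512 * d * 3 ^ (d - 1) * C ^ 2 * n + 5 ^ d * n := add_le_add le_rfl h5
      _ = (5 ^ d + 512 * d * 3 ^ (d - 1) * C ^ 2) * n := by ring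

end LatticeSum

/-! ### Abel summation: the magnetization `M(p,γ) = γ Σ_s (1-γ)^s P(|C(0)| ≥ s+1)` -/

section Magnetization

/-- **The magnetization under the squeeze**: for `0 < γ < 1` and every `n`,
`γ Σ_{s ≥ 0} (1-γ)^s P_p(|C(0)| ≥ s+1) ≤ P_p(0 ↔ ∂Λ_n) + (Σ_{x ∈ Λ_n} τ_p(0,x)) · γ log(1/γ)/(1-γ)`,
by `real_clusterSizeGe_le_oneArmProb_add` termwise and the series `Σ_s (1-γ)^s = 1/γ`,
`Σ_s (1-γ)^{s+1}/(s+1) = log(1/γ)`. The left side is the magnetization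
`M(p,γ) = E_p[1 - (1-γ)^{|C(0)|}]` of Heydenreich–van der Hofstad 2017, (3.4.1), by Abel summation
(`1 - (1-γ)^k = γ Σ_{s<k} (1-γ)^s`, also for `k = ∞`).
[cite: HeydenreichVanDerHofstad2017, (3.4.1) and Prop. 3.6] -/
theorem magnetization_le_oneArmProb_add (p : unitInterval) (n : ℕ) {γ : ℝ} (hγ0 : 0 < γ)
    (hγ1 : γ < 1) :
    γ * ∑' s : ℕ, (1 - γ) ^ s *
        (bondPercolation (zdGraph d) p).real (clusterSizeGe (0 : Site d) (s + 1)) ≤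
      oneArmProb d p n + (∑ x ∈ box d n, tau d p 0 x) * (γ * (-Real.log γ) / (1 - γ)) := by
  set μ := bondPercolation (zdGraph d) p with hμ
  set Sn : ℝ := ∑ x ∈ box d n, tau d p 0 x with hSn
  set π : ℝ := oneArmProb d p n with hπ
  have h1γ0 : 0 < 1 - γ := by linarith
  have h1γ1 : 1 - γ < 1 := by linarith
  -- the two comparison series
  have hgeo : HasSum (fun s : ℕ => (1 - γ) ^ s * π) (γ⁻¹ * π) := by
    have h := hasSum_geometric_of_lt_one h1γ0.le h1γ1
    rw [show (1 - (1 - γ)) = γ by ring] at h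
    exact h.mul_right π
  have hlog : HasSum (fun s : ℕ => Sn * ((1 - γ)⁻¹ * ((1 - γ) ^ (s + 1) / ((s : ℝ) + 1))))
      (Sn * ((1 - γ)⁻¹ * (-Real.log γ))) := by
    have h := Real.hasSum_pow_div_log_of_abs_lt_one (x := 1 - γ)
      (by rw [abs_of_pos h1γ0]; exact h1γ1)
    rw [show (1 - (1 - γ)) = γ by ring] at h
    exact (h.mul_left (1 - γ)⁻¹).mul_left Sn
  have hshift : ∀ s : ℕ, (1 - γ)⁻¹ * ((1 - γ) ^ (s + 1) / ((s : ℝ) + 1)) =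
      (1 - γ) ^ s / ((s : ℝ) + 1) := by
    intro s
    rw [pow_succ]
    field_simp
  -- termwise bound
  have hterm : ∀ s : ℕ, (1 - γ) ^ s * μ.real (clusterSizeGe (0 : Site d) (s + 1)) ≤
      (1 - γ) ^ s * π + Sn * ((1 - γ)⁻¹ * ((1 - γ) ^ (s + 1) / ((s : ℝ) + 1))) := by
    intro s
    have h := real_clusterSizeGe_le_oneArmProb_add (d := d) p n (s := s + 1) (by omega)
    have hpow : 0 ≤ (1 - γ) ^ s := pow_nonneg h1γ0.le s
    have h' : μ.real (clusterSizeGe (0 : Site d) (s + 1)) ≤ π + Sn / ((s : ℝ) + 1) := by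
      have : (((s + 1 : ℕ) : ℝ)) = (s : ℝ) + 1 := by push_cast; ring
      rw [this] at h
      exact h
    calc (1 - γ) ^ s * μ.real (clusterSizeGe (0 : Site d) (s + 1))
        ≤ (1 - γ) ^ s * (π + Sn / ((s : ℝ) + 1)) := mul_le_mul_of_nonneg_left h' hpow
      _ = (1 - γ) ^ s * π + Sn * ((1 - γ) ^ s / ((s : ℝ) + 1)) := by ring
      _ = (1 - γ) ^ s * π + Sn * ((1 - γ)⁻¹ * ((1 - γ) ^ (s + 1) / ((s : ℝ) + 1))) := by
          rw [hshift s]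
  have hnn : ∀ s : ℕ, 0 ≤ (1 - γ) ^ s * μ.real (clusterSizeGe (0 : Site d) (s + 1)) :=
    fun s => mul_nonneg (pow_nonneg h1γ0.le s) measureReal_nonneg
  have hsum_g : Summable (fun s : ℕ => (1 - γ) ^ s * π +
      Sn * ((1 - γ)⁻¹ * ((1 - γ) ^ (s + 1) / ((s : ℝ) + 1)))) :=
    hgeo.summable.add hlog.summable
  have hsum_f : Summable (fun s : ℕ => (1 - γ) ^ s * μ.real (clusterSizeGe (0 : Site d) (s + 1))) :=
    Summable.of_nonneg_of_le hnn hterm hsum_g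
  have htsum : ∑' s : ℕ, (1 - γ) ^ s * μ.real (clusterSizeGe (0 : Site d) (s + 1)) ≤
      γ⁻¹ * π + Sn * ((1 - γ)⁻¹ * (-Real.log γ)) := by
    calc ∑' s : ℕ, (1 - γ) ^ s * μ.real (clusterSizeGe (0 : Site d) (s + 1))
        ≤ ∑' s : ℕ, ((1 - γ) ^ s * π + Sn * ((1 - γ)⁻¹ * ((1 - γ) ^ (s + 1) / ((s : ℝ) + 1)))) :=
          Summable.tsum_le_tsum hterm hsum_f hsum_g
      _ = γ⁻¹ * π + Sn * ((1 - γ)⁻¹ * (-Real.log γ)) := (hgeo.add hlog).tsum_eq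
  calc γ * ∑' s : ℕ, (1 - γ) ^ s * μ.real (clusterSizeGe (0 : Site d) (s + 1))
      ≤ γ * (γ⁻¹ * π + Sn * ((1 - γ)⁻¹ * (-Real.log γ))) :=
        mul_le_mul_of_nonneg_left htsum hγ0.le
    _ = π + Sn * (γ * (-Real.log γ) / (1 - γ)) := by
        field_simp

end Magnetization

/-! ### The sharpened barrier: the one-arm upper bound alone forces `d ≥ 6` -/

section Barrier

/-- **BARRIER (sharpening of `LaceExpansionHighDimension`, Cor. 11.7) — the mean-field one-arm
upper bound alone forces `d ≥ 6`.** On `ℤ^d`, `d ≥ 1`, at any parameter `p`: if the magnetization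
obeys `M(p,γ) = γ Σ_{s≥0} (1-γ)^s P_p(|C(0)| ≥ s+1) ≥ c √γ` for `0 < γ < 1` (at `p = p_c` this is
Aizenman–Barsky 1987, Thm. 1.2, "`M(β_T,h) ≥ const h^{1/2}`", the mean-field bound `δ ≥ 2`, valid
in every dimension) and `P_p(0 ↔ ∂Λ_n) ≤ C/n²` for all `n ≥ 1` (the upper half of `ρ_ex = 1/2`,
(11.3.2)), then `d ≥ 6`. Proof: for `d ≤ 5`, `magnetization_le_oneArmProb_add` and
`sum_tau_box_le_of_oneArm_upper` give, at `γ = 1/(λn⁴)` (`λ = (c/(2C+1))²`, `λ n⁴ ≥ 2`),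
`(2C+1)/n² = c√γ ≤ C/n² + 2K log(λn⁴)/(λ n³)`, i.e. `C + 1 ≤ 2K log(λ n⁴)/(λ n) → 0`.

BARRIER (D-0021 structured block; supersedes the `scope_caveats` of `LaceExpansionHighDimension`):
- technique_class: mean-field one-arm decay — formally: any argument whose output on nearest-neighbour `ℤ^d` includes the upper bound `P_{p_c}(0 ↔ ∂Λ_n) ≤ C n^{-2}` (`n ≥ 1`), in particular "`ρ_ex = 1/2`" (`RhoExHalf d`), whatever it says or does not say about the two-point function; this contains the technique class of `LaceExpansionHighDimension` (which asked in addition for "`η = 0` in `x`-space") [cite: HeydenreichVanDerHofstad2017, Cor. 11.7 and Thm. 11.5 (11.3.2)].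
- blocks: `RhoExHalf d`, indeed its upper half alone, for every `d ≤ 5`, granted the magnetization bound `M(p_c,γ) ≥ c√γ` (`not_rhoExHalf_of_le_five_of_magnetization`, `MeanFieldOneArmHighDimension_holds`); hence also Cor. 11.7's conjunction `EtaZeroXSpace d ∧ RhoExHalf d`, for which the two-point half is idle; NOT excluded (unchanged): `TriangleCondition 3`, an infrared bound in `d = 3`, `EtaZeroXSpace 3` / `TwoPointBoundedRatio 3` on their own, or a proof of `θ(p_c) = 0` in `d = 3` that outputs no mean-field arm decay; `d = 6` is not excluded.
- because: `P(|C(0)| ≥ s) ≤ P(0 ↔ ∂Λ_n) + s^{-1} Σ_{x∈Λ_n} τ(0,x)` and `τ(0,x) ≤ P(0 ↔ ∂Λ_{⌊(‖x‖-1)/2⌋})²` (two disjoint boxes), so a one-arm bound `C n^{-2}` makes `Σ_{Λ_n} τ = O(n)` for `d ≤ 5` and the magnetization `M(p_c,γ) = O(√γ/λ) + o(√γ)` along `γ = (λn⁴)^{-1}`, contradicting `M(p_c,γ) ≥ c√γ` [cite: AizenmanBarsky1987, Thm. 1.2 ((1.10), p. 493)] for `λ` large; this is the hyperscaling inequality `η₁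 ≤ d/(1+δ) ≤ d/3` [cite: BorgsChayesKestenSpencer1999, §1] [cite: DewanMuirhead2022, §1.1 ("it implies d_c ≥ 6 since it shows that η₁ = 2 cannot occur for d ≤ 5") and Thm. 1.1] at the exponent `η₁ = 2`.
- evasions_known: none on nearest-neighbour `ℤ^d`, `d ≤ 5` (the conclusion is a theorem); the INPUT `δ ≥ 2` is unconditional [cite: AizenmanBarsky1987, Thm. 1.2] [cite: HeydenreichVanDerHofstad2017, Prop. 3.6 and Cor. 4.5]; changing the MODEL changes the arm exponent — long-range percolation in `d > 3(α ∧ 2)` has `c/n^{(α∧4)/2} ≤ P_{λ_c}(0 ↔ ℤ^d ∖ Λ_n) ≤ C/n^{(α∧4)/2}` ("`ρ_ex = 1/2` of ordinary percolation changes to `ρ_ex = 2/(α ∧ 4)`") [cite: HeydenreichVanDerHofstad2017, Thm. 15.8] — which is another lattice, not an evasion on `ℤ^d`; for the upper bound itself, new non-lace proofs exist above six dimensions: up to `(log R)^4` from `ν ≤ 1/2` and `η ≥ 0` in any dimension [cite: DewanMuirhead2022, Remark 1.13], and up to constants for spread-out `d > 6` from near-critical inputs (van Engelenburg–Garban–Panis–Severo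 2025, arXiv:2510.21595, Thm. 1.1) — all consistent with the barrier.
- scope_caveats: needs `d ≥ 1` and the magnetization lower bound at the parameter considered (at `p_c`: Aizenman–Barsky, every `d ≥ 2`; trivial when `θ(p_c) > 0`); refutes the one-arm upper bound `≤ C/n²` for ALL `n ≥ 1` with one constant (equivalently for all large `n`), not a bound along a subsequence; says nothing about `d = 6`, about lower bounds on `P_{p_c}(0 ↔ ∂Λ_n)` beyond `d ≤ 5`, or about the two-point function; nearest-neighbour bond percolation on `ℤ^d` only (the proof uses only translation invariance, independence on disjoint edge sets and `|∂Λ_k| ≤ 2d(2k+1)^{d-1}`).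
- status: established (proved here, sorry-free; the printed sources state it through exponents: `η₁ ≤ d/3` [cite: DewanMuirhead2022, Thm. 1.1], `η₁ ≤ d/(1+δ)` [cite: BorgsChayesKestenSpencer1999, §1]).

[cite: DewanMuirhead2022, §1.1 and Thm. 1.1] [cite: BorgsChayesKestenSpencer1999, §1]
[cite: AizenmanBarsky1987, Thm. 1.2] -/
theorem six_le_of_oneArm_upper_of_magnetization (hd : 1 ≤ d) (p : unitInterval)
    (hM : ∃ c : ℝ, 0 < c ∧ ∀ γ : ℝ, 0 < γ → γ < 1 →
      c * Real.sqrt γ ≤ γ * ∑' s : ℕ, (1 - γ) ^ s *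
        (bondPercolation (zdGraph d) p).real (clusterSizeGe (0 : Site d) (s + 1)))
    (hρ : ∃ C : ℝ, ∀ n : ℕ, 1 ≤ n → oneArmProb d p n ≤ C / (n : ℝ) ^ 2) : 6 ≤ d := by
  by_contra hlt
  have hd5 : d ≤ 5 := by omega
  obtain ⟨c, hc, hM⟩ := hM
  obtain ⟨C, hρ⟩ := hρ
  have hC0 : 0 ≤ C := by
    have h := hρ 1 le_rfl
    have h0 : (0 : ℝ) ≤ oneArmProb d p 1 := measureReal_nonneg
    norm_num at h
    linarith
  set K : ℝ := 5 ^ d + 512 * d * 3 ^ (d - 1) * C ^ 2 with hK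
  have hK0 : 0 < K := by positivity
  have h2C1 : 0 < 2 * C + 1 := by linarith
  obtain ⟨lam, hlam⟩ : ∃ l : ℝ, l = (c / (2 * C + 1)) ^ 2 := ⟨_, rfl⟩
  have hlam0 : 0 < lam := by rw [hlam]; positivity
  have hsqrt_lam : Real.sqrt lam = c / (2 * C + 1) := by
    rw [hlam, Real.sqrt_sq (by positivity)]
  -- the key inequality, for every `n ≥ 1` with `λ n⁴ ≥ 2`
  have key : ∀ n : ℕ, 1 ≤ n → 2 ≤ lam * (n : ℝ) ^ 4 →
      C + 1 ≤ 2 * K * Real.log (lam * (n : ℝ) ^ 4) / (lam * n) := by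
    intro n hn hln
    have hn0 : (0 : ℝ) < n := by exact_mod_cast hn
    have hn0' : (n : ℝ) ≠ 0 := hn0.ne'
    have hlam0' : lam ≠ 0 := hlam0.ne'
    have hL0 : 0 < lam * (n : ℝ) ^ 4 := by positivity
    set γ : ℝ := (lam * (n : ℝ) ^ 4)⁻¹ with hγ
    have hγ0 : 0 < γ := by positivity
    have hγhalf : γ ≤ 2⁻¹ := inv_anti₀ (by norm_num) hln
    have hγ1 : γ < 1 := by
      have : (2 : ℝ)⁻¹ < 1 := by norm_num
      linarith
    have h1 := hM γ hγ0 hγ1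
    have h2 := magnetization_le_oneArmProb_add (d := d) p n hγ0 hγ1
    have h3 := sum_tau_box_le_of_oneArm_upper hd hd5 p hρ hn
    have h4 := hρ n hn
    have hsqrtγ : Real.sqrt γ = (Real.sqrt lam * (n : ℝ) ^ 2)⁻¹ := by
      have hn4 : Real.sqrt ((n : ℝ) ^ 4) = (n : ℝ) ^ 2 := by
        rw [show ((n : ℝ) ^ 4) = ((n : ℝ) ^ 2) ^ 2 by ring]
        exact Real.sqrt_sq (by positivity)
      rw [hγ, Real.sqrt_inv, Real.sqrt_mul hlam0.le, hn4]
    have hlogγ : -Real.log γ = Real.log (lam * (n : ℝ) ^ 4) := by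
      rw [hγ, Real.log_inv, neg_neg]
    have hlog0 : 0 ≤ Real.log (lam * (n : ℝ) ^ 4) := Real.log_nonneg (by linarith)
    have h1γ : (1 - γ)⁻¹ ≤ 2 := by
      rw [inv_le_comm₀ (by linarith) (by norm_num : (0 : ℝ) < 2)]
      linarith
    have hfrac : γ * (-Real.log γ) / (1 - γ) ≤ 2 * γ * Real.log (lam * (n : ℝ) ^ 4) := by
      rw [hlogγ, div_eq_mul_inv]
      calc γ * Real.log (lam * (n : ℝ) ^ 4) * (1 - γ)⁻¹
          ≤ γ * Real.log (lam * (n : ℝ) ^ 4) * 2 :=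
            mul_le_mul_of_nonneg_left h1γ (mul_nonneg hγ0.le hlog0)
        _ = 2 * γ * Real.log (lam * (n : ℝ) ^ 4) := by ring
    have hfrac0 : 0 ≤ γ * (-Real.log γ) / (1 - γ) := by
      rw [hlogγ]
      exact div_nonneg (mul_nonneg hγ0.le hlog0) (by linarith)
    have hSn0 : 0 ≤ ∑ x ∈ box d n, tau d p 0 x := Finset.sum_nonneg fun x _ => tau_nonneg p 0 x
    have hmain : c * Real.sqrt γ ≤
        C / (n : ℝ) ^ 2 + K * n * (2 * γ * Real.log (lam * (n : ℝ) ^ 4)) := by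
      calc c * Real.sqrt γ ≤ _ := h1
        _ ≤ oneArmProb d p n + (∑ x ∈ box d n, tau d p 0 x) * (γ * (-Real.log γ) / (1 - γ)) := h2
        _ ≤ C / (n : ℝ) ^ 2 + K * n * (2 * γ * Real.log (lam * (n : ℝ) ^ 4)) :=
            add_le_add h4 (mul_le_mul h3 hfrac hfrac0 (by positivity))
    have hcsq : c * Real.sqrt γ = (2 * C + 1) / (n : ℝ) ^ 2 := by
      rw [hsqrtγ, hsqrt_lam]
      field_simp
    have hKn : K * n * (2 * γ * Real.log (lam * (n : ℝ) ^ 4)) =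
        (2 * K * Real.log (lam * (n : ℝ) ^ 4) / (lam * n)) / (n : ℝ) ^ 2 := by
      rw [hγ]
      field_simp
    rw [hcsq, hKn, ← add_div, div_le_div_iff_of_pos_right (by positivity)] at hmain
    linarith
  -- the right-hand side tends to `0`
  have hlim : Tendsto (fun n : ℕ => 2 * K * Real.log (lam * (n : ℝ) ^ 4) / (lam * n))
      atTop (𝓝 0) := by
    have h1 : Tendsto (fun x : ℝ => Real.log x ^ 1 / (1 * x + 0)) atTop (𝓝 0) :=
      Real.tendsto_pow_log_div_mul_add_atTop 1 0 1 one_ne_zero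
    have h2 : Tendsto (fun n : ℕ => Real.log (n : ℝ) / (n : ℝ)) atTop (𝓝 0) := by
      have := h1.comp tendsto_natCast_atTop_atTop
      refine this.congr' (Eventually.of_forall fun n => ?_)
      simp [Function.comp]
    have h3 : Tendsto (fun n : ℕ => Real.log lam / (n : ℝ)) atTop (𝓝 0) :=
      tendsto_const_div_atTop_nhds_zero_nat _
    have h4 : Tendsto (fun n : ℕ => (2 * K / lam) *
        (Real.log lam / (n : ℝ) + 4 * (Real.log (n : ℝ) / (n : ℝ)))) atTop (𝓝 0) := by
      have := (h3.add (h2.const_mul 4)).const_mul (2 * K / lam)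
      simpa using this
    refine h4.congr' ?_
    filter_upwards [eventually_ge_atTop 1] with n hn
    have hn0 : (0 : ℝ) < n := by exact_mod_cast hn
    rw [Real.log_mul hlam0.ne' (by positivity), Real.log_pow]
    field_simp
    ring
  have hev1 : ∀ᶠ n : ℕ in atTop, 2 * K * Real.log (lam * (n : ℝ) ^ 4) / (lam * n) < C + 1 :=
    hlim.eventually (gt_mem_nhds (by linarith))
  have hev2 : ∀ᶠ n : ℕ in atTop, 2 ≤ lam * (n : ℝ) ^ 4 := by
    have ht : Tendsto (fun n : ℕ => lam * (n : ℝ) ^ 4) atTop atTop :=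
      Tendsto.const_mul_atTop hlam0
        ((tendsto_pow_atTop (by norm_num : (4 : ℕ) ≠ 0)).comp tendsto_natCast_atTop_atTop)
    exact ht.eventually_ge_atTop 2
  obtain ⟨n, ⟨hn1, hn2⟩, hn3⟩ := (((eventually_ge_atTop 1).and hev1).and hev2).exists
  have := key n hn1 hn3
  linarith

/-- **`ρ_ex = 1/2` alone forces `d ≥ 6`** (catalogue form): `RhoExHalf d` — indeed only its upper
half — together with the Aizenman–Barsky magnetization bound at `p_c` implies `6 ≤ d`.
Compare `LaceExpansionHighDimension_holds`, which needs `EtaZeroXSpace d` as well.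
[cite: DewanMuirhead2022, §1.1 and Thm. 1.1] [cite: AizenmanBarsky1987, Thm. 1.2] -/
theorem RhoExHalf.six_le_of_magnetization (hd : 1 ≤ d) (hρ : RhoExHalf d)
    (hM : ∃ c : ℝ, 0 < c ∧ ∀ γ : ℝ, 0 < γ → γ < 1 →
      c * Real.sqrt γ ≤ γ * ∑' s : ℕ, (1 - γ) ^ s *
        (bondPercolation (zdGraph d) (criticalProbI d)).real (clusterSizeGe (0 : Site d) (s + 1))) :
    6 ≤ d := by
  obtain ⟨_, C, -, h⟩ := hρ
  exact six_le_of_oneArm_upper_of_magnetization hd (criticalProbI d) hM ⟨C, fun n hn => (h n hn).2⟩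

/-- In particular `ρ_ex = 1/2` ((11.3.2), `RhoExHalf d`) fails in every dimension `1 ≤ d ≤ 5`,
granted the magnetization bound `M(p_c,γ) ≥ c√γ` (Aizenman–Barsky 1987, Thm. 1.2, unconditional for
`d ≥ 2`) — without any hypothesis on the two-point function (contrast
`TwoPointBoundedRatio.not_rhoExHalf_three`). [cite: DewanMuirhead2022, §1.1 ("η₁ = 2 cannot occur for d ≤ 5")]
[cite: AizenmanBarsky1987, Thm. 1.2] -/
theorem not_rhoExHalf_of_le_five_of_magnetization (hd1 : 1 ≤ d) (hd5 : d ≤ 5)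
    (hM : ∃ c : ℝ, 0 < c ∧ ∀ γ : ℝ, 0 < γ → γ < 1 →
      c * Real.sqrt γ ≤ γ * ∑' s : ℕ, (1 - γ) ^ s *
        (bondPercolation (zdGraph d) (criticalProbI d)).real (clusterSizeGe (0 : Site d) (s + 1))) :
    ¬ RhoExHalf d := fun hρ => by
  have := hρ.six_le_of_magnetization hd1 hM
  omega

/-- **BARRIER — mean-field one-arm decay is a high-dimensional statement (`d ≥ 6`); Cor. 11.7
sharpened, as a catalogue statement** (the D-0021 audit's replacement of the `RhoExHalf` half of
`LaceExpansionHighDimension`): for every `d ≥ 1`, the Aizenman–Barsky magnetization bound at `p_c`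
(`M(p_c,γ) = γ Σ_{s≥0} (1-γ)^s P_{p_c}(|C(0)| ≥ s+1) ≥ c√γ` for `0 < γ < 1`, i.e. `δ ≥ 2` in the
printed generating-function sense, unconditional in every `d ≥ 2`) and the one-arm upper bound
`P_{p_c}(0 ↔ ∂Λ_n) ≤ C/n²` (`n ≥ 1`, the upper half of (11.3.2)) imply `d ≥ 6` — the hypothesis
`EtaZeroXSpace d` of `LaceExpansionHighDimension` is dropped. The structured BARRIER block is on
`six_le_of_oneArm_upper_of_magnetization`; PROVED below (`MeanFieldOneArmHighDimension_holds`).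
Users take `(h : MeanFieldOneArmHighDimension)` or use `MeanFieldOneArmHighDimension_holds`.
[cite: DewanMuirhead2022, §1.1 and Thm. 1.1] [cite: HeydenreichVanDerHofstad2017, Cor. 11.7]
[cite: AizenmanBarsky1987, Thm. 1.2] -/
def MeanFieldOneArmHighDimension : Prop :=
  ∀ d : ℕ, 1 ≤ d →
    (∃ c : ℝ, 0 < c ∧ ∀ γ : ℝ, 0 < γ → γ < 1 →
      c * Real.sqrt γ ≤ γ * ∑' s : ℕ, (1 - γ) ^ s *
        (bondPercolation (zdGraph d) (criticalProbI d)).real (clusterSizeGe (0 : Site d) (s + 1))) →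
    (∃ C : ℝ, ∀ n : ℕ, 1 ≤ n → oneArmProb d (criticalProbI d) n ≤ C / (n : ℝ) ^ 2) → 6 ≤ d

/-- `MeanFieldOneArmHighDimension` holds (by `six_le_of_oneArm_upper_of_magnetization` at
`p = p_c`). [cite: DewanMuirhead2022, §1.1 and Thm. 1.1] [cite: AizenmanBarsky1987, Thm. 1.2] -/
theorem MeanFieldOneArmHighDimension_holds : MeanFieldOneArmHighDimension :=
  fun d hd hM hρ => six_le_of_oneArm_upper_of_magnetization hd (criticalProbI d) hM hρ

/-- The sharpened statement implies the catalogued one on its own terms: under the magnetization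
bound, `LaceExpansionHighDimension`'s conclusion needs only its `RhoExHalf` hypothesis.
[cite: HeydenreichVanDerHofstad2017, Cor. 11.7] -/
theorem MeanFieldOneArmHighDimension.of_rhoExHalf (h : MeanFieldOneArmHighDimension)
    (hd : 1 ≤ d)
    (hM : ∃ c : ℝ, 0 < c ∧ ∀ γ : ℝ, 0 < γ → γ < 1 →
      c * Real.sqrt γ ≤ γ * ∑' s : ℕ, (1 - γ) ^ s *
        (bondPercolation (zdGraph d) (criticalProbI d)).real (clusterSizeGe (0 : Site d) (s + 1)))
    (hρ : RhoExHalf d) : 6 ≤ d := by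
  obtain ⟨_, C, -, h'⟩ := hρ
  exact h d hd hM ⟨C, fun n hn => (h' n hn).2⟩

end Barrier

end Literature.Barriers.CriticalPhenomena

end
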